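import Literature.NumberTheory.Sieve.CFSemigroupLogLipschitz
import Literature.NumberTheory.Sieve.CFSemigroupEigenmeasure
import HarnessLib

/-!
# The spectral gap of the transfer operator of `Γ_A` (Ruelle–Perron–Frobenius, part (3))

Support file (all results proved) for the named fact
`Literature.NumberTheory.Sieve.MageeOhWinter2019_uniformCounting` (`CFSemigroupCounting.lean`).
[MageeOhWinter2019, Thm. 10 (3)] (after Ruelle, Bowen, Naud): for real `s` the transfer operator
`L_s = L_{-sτ}` of the continued fractions semigroup, acting on Lipschitz functions on `[0,1]`,
has `e^{P(s)}` as a simple maximal eigenvalue with a spectral gap; equivalently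
`e^{-nP(s)} L_sⁿ f → (∫ f dν) h` exponentially fast, uniformly on `[0,1]`, where `h` is the
positive eigenfunction (`CFSemigroupEigenfunction.lean`) and `ν` the eigenmeasure
(`CFSemigroupEigenmeasure.lean`), normalised by `∫ h dν = 1`.

We prove this in the concrete form needed for the renewal theory of §3, following Bowen's proof
of Ruelle's theorem (*Equilibrium states*, Lemmas 1.8–1.12) on the cones
`C_K = {f > 0 : f(x) ≤ e^{K|x-y|} f(y)}` of log-Lipschitz functions (`CfCone`), with the cone
contraction `L_s² C_K ⊆ C_{2s + K/2}` of `CFSemigroupLogLipschitz.lean`: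

* `CfCone.sub_smul` (Bowen's Lemma 1.11): for `F ∈ C_{K'}`, `K' < K`, `h ∈ C_{2s}` and `η`
  small (explicit), `F - η h ∈ C_K`;
* `cfBowen_unroll`, `cfBowen_iterate_mem`: with `K = 4s+2`, `K' = 4s+1`, `η = cfEta s` and the
  normalisation `∫ f dν = 1`, `e^{-2kP} L_s^{2k} f = (1 - (1-η)^k) h + (1-η)^k f_k` with
  `f_k ∈ C_K`, `∫ f_k dν = 1`;
* `cfTransfer_decay_cone`, `cfTransfer_decay_lipschitz`: for every probability eigenmeasure `ν`
  and normalised eigenfunction `h ∈ C_{2s}`,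
  `|e^{-nP(s)} (L_sⁿ f)(x) - (∫ f dν) h(x)| ≤ C(s) θ(s)ⁿ (‖f‖_∞ + Lip(f))` on `[0,1]` with
  explicit `C(s) = cfGapConst s`, `θ(s) = cfTheta s ∈ (0,1)`;
* `cfTransfer_spectralGap`: existence of such `h, ν` (from Thm. 10 (1), (2)) together with the
  exponential convergence — [MageeOhWinter2019, Thm. 10 (3)] for `Γ_A` on Lipschitz functions.

## References

* M. Magee, H. Oh, D. Winter, J. reine angew. Math. 753 (2019) 89–135, Thm. 10.
  [MageeOhWinter2019]
* R. Bowen, *Equilibrium states and the ergodic theory of Anosov diffeomorphisms*, LNM 470,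
  2nd ed. (2008), Thm. 1.7 and Lemmas 1.8–1.12.
-/

noncomputable section

open Filter Set MeasureTheory
open scoped Topology

namespace Literature.NumberTheory.Sieve

variable {A : Finset ℕ}

/-! ### The cones `C_K` of positive log-Lipschitz functions on `[0,1]` -/

/-- The Birkhoff–Bowen cone `C_K`: `f > 0` on `[0,1]` and `f(x) ≤ e^{K|x-y|} f(y)` for
`x, y ∈ [0,1]`. [folklore] -/
structure CfCone (K : ℝ) (f : ℝ → ℝ) : Prop where
  pos : ∀ y ∈ Icc (0 : ℝ) 1, 0 < f y
  le : ∀ x ∈ Icc (0 : ℝ) 1, ∀ y ∈ Icc (0 : ℝ) 1, f x ≤ Real.exp (K * |x - y|) * f y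

namespace CfCone

variable {K K' : ℝ} {f : ℝ → ℝ}

/-- `C_K ⊆ C_{K'}` for `K ≤ K'`. [folklore] -/
theorem mono (h : CfCone K f) (hKK' : K ≤ K') : CfCone K' f :=
  ⟨h.pos, fun x hx y hy => (h.le x hx y hy).trans (mul_le_mul_of_nonneg_right
    (Real.exp_le_exp.2 (mul_le_mul_of_nonneg_right hKK' (abs_nonneg _))) (h.pos y hy).le)⟩

/-- Positive constants lie in every `C_K`, `K ≥ 0`. [folklore] -/
theorem const {c : ℝ} (hc : 0 < c) (hK : 0 ≤ K) : CfCone K (fun _ => c) :=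
  ⟨fun _ _ => hc, fun x _ y _ =>
    le_mul_of_one_le_left hc.le (Real.one_le_exp (mul_nonneg hK (abs_nonneg (x - y))))⟩

/-- `C_K` is stable under positive scalars. [folklore] -/
theorem smul (h : CfCone K f) {c : ℝ} (hc : 0 < c) : CfCone K (fun y => c * f y) :=
  ⟨fun y hy => mul_pos hc (h.pos y hy), fun x hx y hy => by
    rw [mul_left_comm]
    exact mul_le_mul_of_nonneg_left (h.le x hx y hy) hc.le⟩

/-- The ratio bound `f(x) ≤ e^K f(y)` on `[0,1]`. [folklore] -/
theorem le_exp_mul (h : CfCone K f) (hK : 0 ≤ K) {x y : ℝ} (hx : x ∈ Icc (0 : ℝ) 1)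
    (hy : y ∈ Icc (0 : ℝ) 1) : f x ≤ Real.exp K * f y :=
  le_exp_mul_of_logLip hK h.le h.pos hx hy

/-- Elements of `C_K` bounded by `M` are Lipschitz with constant `K e^K M`. [folklore] -/
theorem abs_sub_le (h : CfCone K f) (hK : 0 ≤ K) {M : ℝ} (hM : ∀ y ∈ Icc (0 : ℝ) 1, f y ≤ M)
    {x y : ℝ} (hx : x ∈ Icc (0 : ℝ) 1) (hy : y ∈ Icc (0 : ℝ) 1) :
    |f x - f y| ≤ K * Real.exp K * M * |x - y| := by
  have key : ∀ {u v : ℝ}, u ∈ Icc (0 : ℝ) 1 → v ∈ Icc (0 : ℝ) 1 →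
      f u - f v ≤ K * Real.exp K * M * |u - v| := by
    intro u v hu hv
    have hd1 : |u - v| ≤ 1 := by
      rw [abs_le]; constructor <;> linarith [hu.1, hu.2, hv.1, hv.2]
    have hd0 : 0 ≤ |u - v| := abs_nonneg _
    have hfv := h.pos v hv
    have ht : 0 ≤ K * |u - v| := mul_nonneg hK hd0
    have hexp : Real.exp (K * |u - v|) ≤ Real.exp K := Real.exp_le_exp.2 (by nlinarith)
    have hprod : Real.exp (K * |u - v|) * Real.exp (-(K * |u - v|)) = 1 := by
      rw [← Real.exp_add, add_neg_cancel, Real.exp_zero]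
    have h1 : Real.exp (K * |u - v|) - 1 ≤ K * |u - v| * Real.exp (K * |u - v|) := by
      nlinarith [Real.add_one_le_exp (-(K * |u - v|)), Real.exp_pos (K * |u - v|),
        Real.exp_pos (-(K * |u - v|))]
    have h2 : K * |u - v| * Real.exp (K * |u - v|) ≤ K * |u - v| * Real.exp K :=
      mul_le_mul_of_nonneg_left hexp ht
    calc f u - f v ≤ (Real.exp (K * |u - v|) - 1) * f v := by
          have := h.le u hu v hv; linarith
      _ ≤ (K * |u - v| * Real.exp K) * M := mul_le_mul (h1.trans h2) (hM v hv) hfv.le (by positivity)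
      _ = K * Real.exp K * M * |u - v| := by ring
  rw [abs_le]
  constructor
  · have := key hy hx
    rw [abs_sub_comm] at this
    linarith
  · exact key hx hy

/-- Elements of `C_K` are continuous on `[0,1]`. [folklore] -/
theorem continuousOn (h : CfCone K f) (hK : 0 ≤ K) : ContinuousOn f (Icc 0 1) := by
  have hM : ∀ y ∈ Icc (0 : ℝ) 1, f y ≤ Real.exp K * f 0 :=
    fun y hy => h.le_exp_mul hK hy ⟨le_rfl, zero_le_one⟩
  have hL : LipschitzOnWith (K * Real.exp K * (Real.exp K * f 0)).toNNReal f (Icc 0 1) := by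
    refine LipschitzOnWith.of_dist_le_mul fun x hx y hy => ?_
    rw [Real.dist_eq, Real.dist_eq]
    exact (h.abs_sub_le hK hM hx hy).trans
      (mul_le_mul_of_nonneg_right (Real.le_coe_toNNReal _) (abs_nonneg _))
  exact hL.continuousOn

/-- **Lipschitz functions enter the cone after adding a constant:** if `|f| ≤ M` and
`Lip(f) ≤ L` on `[0,1]`, `K > 0` and `c > M + L/K`, then `f + c ∈ C_K`. [folklore] -/
theorem of_lipschitz {f : ℝ → ℝ} {K M L c : ℝ} (hK : 0 < K) (hL : 0 ≤ L) (hc : M + L / K < c)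
    (hM : ∀ y ∈ Icc (0 : ℝ) 1, |f y| ≤ M)
    (hf : ∀ x ∈ Icc (0 : ℝ) 1, ∀ y ∈ Icc (0 : ℝ) 1, |f x - f y| ≤ L * |x - y|) :
    CfCone K (fun y => f y + c) := by
  have hLK : 0 ≤ L / K := div_nonneg hL hK.le
  have hlow : ∀ y ∈ Icc (0 : ℝ) 1, L / K < f y + c := by
    intro y hy
    have := (abs_le.1 (hM y hy)).1
    linarith
  refine ⟨fun y hy => lt_of_le_of_lt hLK (hlow y hy), fun x hx y hy => ?_⟩
  have hd0 : 0 ≤ |x - y| := abs_nonneg _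
  have h1 : f x ≤ f y + L * |x - y| := by
    have := (abs_le.1 (hf x hx y hy)).2
    linarith
  have h2 : K * |x - y| + 1 ≤ Real.exp (K * |x - y|) := Real.add_one_le_exp _
  have h3 : L * |x - y| ≤ (Real.exp (K * |x - y|) - 1) * (f y + c) := by
    calc L * |x - y| = K * |x - y| * (L / K) := by
          rw [← mul_div_assoc, eq_div_iff hK.ne']; ring
      _ ≤ (Real.exp (K * |x - y|) - 1) * (f y + c) :=
          mul_le_mul (by linarith) (hlow y hy).le hLK (by linarith [mul_nonneg hK.le hd0])
  linarith [h3]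

/-- **Positive Lipschitz functions bounded below lie in a cone:** if `Lip(f) ≤ L` and `f ≥ m > 0`
on `[0,1]` then `f ∈ C_{L/m}`. [folklore] -/
theorem of_lipschitz_of_pos {f : ℝ → ℝ} {L m : ℝ} (hL : 0 ≤ L) (hm : 0 < m)
    (hfm : ∀ y ∈ Icc (0 : ℝ) 1, m ≤ f y)
    (hf : ∀ x ∈ Icc (0 : ℝ) 1, ∀ y ∈ Icc (0 : ℝ) 1, |f x - f y| ≤ L * |x - y|) :
    CfCone (L / m) f := by
  refine ⟨fun y hy => hm.trans_le (hfm y hy), fun x hx y hy => ?_⟩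
  have hd0 : 0 ≤ |x - y| := abs_nonneg _
  have h1 : f x ≤ f y + L * |x - y| := by
    have := (abs_le.1 (hf x hx y hy)).2
    linarith
  have h2 : L / m * |x - y| + 1 ≤ Real.exp (L / m * |x - y|) := Real.add_one_le_exp _
  have hfy := hfm y hy
  have h3 : L * |x - y| ≤ (Real.exp (L / m * |x - y|) - 1) * f y := by
    calc L * |x - y| = L / m * |x - y| * m := by
          rw [div_mul_eq_mul_div, div_mul_cancel₀ _ hm.ne']
      _ ≤ (Real.exp (L / m * |x - y|) - 1) * f y :=
          mul_le_mul (by linarith) hfy hm.le (by linarith [mul_nonneg (div_nonneg hL hm.le) hd0])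
  linarith [h3]

end CfCone

/-! ### The eigenfunction lies in `C_{2s}` -/

section EigenCone

variable (hA : ∀ a ∈ A, 1 ≤ a)
include hA

/-- **The positive eigenfunction lies in `C_{2s}`:** if `h ∈ C_{K_h}` for some `K_h` and
`L_s h = e^{P_A(s)} h` on `[0,1]`, then `h ∈ C_{2s}` (from `h = λ^{-n} L_sⁿ h ∈ C_{2s + K_h 2^{1-n}}`
for all `n`). [cite: MageeOhWinter2019, Thm. 10] -/
theorem cfCone_eigen_two_mul {s : ℝ} (hs : 0 ≤ s) {h : ℝ → ℝ} {Kh : ℝ} (hKh : 0 ≤ Kh)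
    (hh : CfCone Kh h) (heig : ∀ x ∈ Icc (0 : ℝ) 1, cfTransfer A s h x = cfEig A s * h x) :
    CfCone (2 * s) h := by
  refine ⟨hh.pos, fun x hx y hy => ?_⟩
  have hlam : ∀ n : ℕ, 0 < cfEig A s ^ n := fun n => pow_pos (cfEig_pos s) n
  have hn : ∀ n : ℕ,
      h x ≤ Real.exp ((2 * s + Kh * (1 / 2 : ℝ) ^ (n - 1)) * |x - y|) * h y := by
    intro n
    have h1 := cfTransfer_iterate_logLip hA hs n hKh hh.pos hh.le hx hy
    rw [cfTransfer_iterate_of_eigen hA heig n hx, cfTransfer_iterate_of_eigen hA heig n hy,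
      mul_left_comm] at h1
    exact le_of_mul_le_mul_left h1 (hlam n)
  have hg : Tendsto (fun n : ℕ => (1 / 2 : ℝ) ^ (n - 1)) atTop (𝓝 0) :=
    (tendsto_pow_atTop_nhds_zero_of_lt_one (by norm_num) (by norm_num)).comp
      (tendsto_sub_atTop_nat 1)
  have hlim : Tendsto (fun n : ℕ => Real.exp ((2 * s + Kh * (1 / 2 : ℝ) ^ (n - 1)) * |x - y|) * h y)
      atTop (𝓝 (Real.exp ((2 * s + Kh * 0) * |x - y|) * h y)) :=
    ((Real.continuous_exp.tendsto _).comp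
      ((tendsto_const_nhds.add (tendsto_const_nhds.mul hg)).mul tendsto_const_nhds)).mul
      tendsto_const_nhds
  rw [mul_zero, add_zero] at hlim
  exact ge_of_tendsto' hlim hn

end EigenCone

/-! ### Bowen's contraction step -/

/-- The elementary inequality behind Bowen's Lemma 1.11 on an interval of length `1`:
`e^{Kd} - e^{-2sd} ≤ ((K+2s)e^K/(K-K')) (e^{Kd} - e^{K'd})` for `0 ≤ d ≤ 1`, `0 ≤ K' < K`,
`s ≥ 0`. [folklore] -/
theorem exp_sub_exp_le_mul {K K' s d : ℝ} (hK' : 0 ≤ K') (hKK' : K' < K) (hs : 0 ≤ s)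
    (hd0 : 0 ≤ d) (hd1 : d ≤ 1) :
    Real.exp (K * d) - Real.exp (-(2 * s) * d) ≤
      (K + 2 * s) * Real.exp K / (K - K') * (Real.exp (K * d) - Real.exp (K' * d)) := by
  have hK0 : 0 < K := lt_of_le_of_lt hK' hKK'
  have hgap : 0 < K - K' := sub_pos.2 hKK'
  -- upper bound for the left-hand side
  have hup : Real.exp (K * d) - Real.exp (-(2 * s) * d) ≤ (K + 2 * s) * d * Real.exp K := by
    have hu0 : 0 ≤ (K + 2 * s) * d := by positivity
    have hsplit : Real.exp (K * d) = Real.exp (-(2 * s) * d) * Real.exp ((K + 2 * s) * d) := by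
      rw [← Real.exp_add]; congr 1; ring
    have hprod : Real.exp ((K + 2 * s) * d) * Real.exp (-((K + 2 * s) * d)) = 1 := by
      rw [← Real.exp_add, add_neg_cancel, Real.exp_zero]
    have h1 : Real.exp ((K + 2 * s) * d) - 1 ≤ ((K + 2 * s) * d) * Real.exp ((K + 2 * s) * d) := by
      nlinarith [Real.add_one_le_exp (-((K + 2 * s) * d)), Real.exp_pos ((K + 2 * s) * d),
        Real.exp_pos (-((K + 2 * s) * d))]
    have h3 : Real.exp (K * d) ≤ Real.exp K := Real.exp_le_exp.2 (by nlinarith)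
    calc Real.exp (K * d) - Real.exp (-(2 * s) * d)
        = Real.exp (-(2 * s) * d) * (Real.exp ((K + 2 * s) * d) - 1) := by rw [hsplit]; ring
      _ ≤ Real.exp (-(2 * s) * d) * (((K + 2 * s) * d) * Real.exp ((K + 2 * s) * d)) :=
          mul_le_mul_of_nonneg_left h1 (Real.exp_pos _).le
      _ = (K + 2 * s) * d * Real.exp (K * d) := by rw [hsplit]; ring
      _ ≤ (K + 2 * s) * d * Real.exp K := mul_le_mul_of_nonneg_left h3 hu0
  -- lower bound for the bracket
  have hlow : (K - K') * d ≤ Real.exp (K * d) - Real.exp (K' * d) := by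
    have hsplit : Real.exp (K * d) = Real.exp (K' * d) * Real.exp ((K - K') * d) := by
      rw [← Real.exp_add]; congr 1; ring
    have h1 : (K - K') * d + 1 ≤ Real.exp ((K - K') * d) := Real.add_one_le_exp _
    have h2 : 1 ≤ Real.exp (K' * d) := Real.one_le_exp (by positivity)
    have h3 : 0 ≤ (K - K') * d := by positivity
    rw [hsplit]
    nlinarith [mul_nonneg (sub_nonneg.2 h2) (by linarith : (0 : ℝ) ≤ Real.exp ((K - K') * d) - 1)]
  calc Real.exp (K * d) - Real.exp (-(2 * s) * d) ≤ (K + 2 * s) * d * Real.exp K := hup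
    _ = (K + 2 * s) * Real.exp K / (K - K') * ((K - K') * d) := by
        rw [div_mul_eq_mul_div, eq_div_iff hgap.ne']; ring
    _ ≤ (K + 2 * s) * Real.exp K / (K - K') * (Real.exp (K * d) - Real.exp (K' * d)) :=
        mul_le_mul_of_nonneg_left hlow
          (div_nonneg (mul_nonneg (by linarith) (Real.exp_pos K).le) hgap.le)

/-- **Bowen's decomposition step** ([Bowen, Lemma 1.11] on `[0,1]`): if `F ∈ C_{K'}` with
`F ≥ m > 0`, `h ∈ C_{2s}` with `h ≤ M_h`, `0 ≤ K' < K` and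
`η M_h (K+2s)e^K/(K-K') ≤ m/2`, `η ≥ 0`, then `F - η h ∈ C_K`. [folklore] -/
theorem CfCone.sub_smul {K K' s : ℝ} (hK' : 0 ≤ K') (hKK' : K' < K) (hs : 0 ≤ s) {F h : ℝ → ℝ}
    (hF : CfCone K' F) (hh : CfCone (2 * s) h) {m Mh η : ℝ} (hm : 0 < m)
    (hFm : ∀ y ∈ Icc (0 : ℝ) 1, m ≤ F y) (hhM : ∀ y ∈ Icc (0 : ℝ) 1, h y ≤ Mh) (hη : 0 ≤ η)
    (hηR : η * Mh * ((K + 2 * s) * Real.exp K / (K - K')) ≤ m / 2) :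
    CfCone K (fun y => F y - η * h y) := by
  have hK0 : 0 < K := lt_of_le_of_lt hK' hKK'
  have hgap : 0 < K - K' := sub_pos.2 hKK'
  have h0I : (0 : ℝ) ∈ Icc (0 : ℝ) 1 := ⟨le_rfl, zero_le_one⟩
  have hMh : 0 < Mh := (hh.pos 0 h0I).trans_le (hhM 0 h0I)
  set R : ℝ := (K + 2 * s) * Real.exp K / (K - K') with hR
  have hR0 : 0 ≤ R := div_nonneg (mul_nonneg (by linarith) (Real.exp_pos K).le) hgap.le
  have hR1 : 1 ≤ R := by
    rw [hR, le_div_iff₀ hgap, one_mul]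
    have : 1 ≤ Real.exp K := Real.one_le_exp hK0.le
    nlinarith [mul_nonneg (by linarith : (0 : ℝ) ≤ K + 2 * s) (sub_nonneg.2 this)]
  have hηMh : η * Mh ≤ m / 2 := by nlinarith [mul_nonneg hη hMh.le]
  refine ⟨fun y hy => ?_, fun x hx y hy => ?_⟩
  · have h1 := hFm y hy
    have h2 : η * h y ≤ η * Mh := mul_le_mul_of_nonneg_left (hhM y hy) hη
    linarith
  · have hd0 : 0 ≤ |x - y| := abs_nonneg _
    have hd1 : |x - y| ≤ 1 := by
      rw [abs_le]; constructor <;> linarith [hx.1, hx.2, hy.1, hy.2]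
    have hFxy := hF.le x hx y hy
    have hhyx := hh.le y hy x hx
    rw [abs_sub_comm] at hhyx
    have hE := exp_sub_exp_le_mul hK' hKK' hs hd0 hd1
    rw [← hR] at hE
    have hpos_hy := hh.pos y hy
    have hEE' : Real.exp (K' * |x - y|) ≤ Real.exp (K * |x - y|) :=
      Real.exp_le_exp.2 (mul_le_mul_of_nonneg_right hKK'.le hd0)
    -- `h x ≥ e^{-2s d} h y`
    have hinv : Real.exp (-(2 * s) * |x - y|) * Real.exp (2 * s * |x - y|) = 1 := by
      rw [← Real.exp_add]; convert Real.exp_zero using 2; ring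
    have h1 : Real.exp (-(2 * s) * |x - y|) * h y ≤ h x := by
      have := mul_le_mul_of_nonneg_left hhyx (Real.exp_pos (-(2 * s) * |x - y|)).le
      rw [← mul_assoc, hinv, one_mul] at this
      exact this
    have step1 : η * (Real.exp (-(2 * s) * |x - y|) * h y) ≤ η * h x :=
      mul_le_mul_of_nonneg_left h1 hη
    have step2 : η * (h y * (Real.exp (K * |x - y|) - Real.exp (-(2 * s) * |x - y|))) ≤
        η * (h y * (R * (Real.exp (K * |x - y|) - Real.exp (K' * |x - y|)))) :=
      mul_le_mul_of_nonneg_left (mul_le_mul_of_nonneg_left hE hpos_hy.le) hη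
    have step3 : η * (h y * (R * (Real.exp (K * |x - y|) - Real.exp (K' * |x - y|)))) ≤
        η * (Mh * (R * (Real.exp (K * |x - y|) - Real.exp (K' * |x - y|)))) :=
      mul_le_mul_of_nonneg_left
        (mul_le_mul_of_nonneg_right (hhM y hy) (mul_nonneg hR0 (sub_nonneg.2 hEE'))) hη
    have step4 : η * Mh * R * (Real.exp (K * |x - y|) - Real.exp (K' * |x - y|)) ≤
        m / 2 * (Real.exp (K * |x - y|) - Real.exp (K' * |x - y|)) :=
      mul_le_mul_of_nonneg_right hηR (sub_nonneg.2 hEE')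
    have step5 : m / 2 * (Real.exp (K * |x - y|) - Real.exp (K' * |x - y|)) ≤
        F y * (Real.exp (K * |x - y|) - Real.exp (K' * |x - y|)) :=
      mul_le_mul_of_nonneg_right (by linarith [hFm y hy]) (sub_nonneg.2 hEE')
    linarith [step1, step2, step3, step4, step5, hFxy]

/-! ### Integration against a measure on `[0,1]` -/

/-- `∫_{[0,1]} g dν` for `g : ℝ → ℝ` and a measure `ν` on `[0,1]`. [folklore] -/
def cfInt (ν : Measure (Icc (0 : ℝ) 1)) (g : ℝ → ℝ) : ℝ := ∫ x, g x ∂ν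

section Integral

variable (ν : Measure (Icc (0 : ℝ) 1))

/-- Continuous functions on `[0,1]` are `ν`-integrable for finite `ν`. [folklore] -/
theorem cfIntegrable [IsFiniteMeasure ν] {g : ℝ → ℝ} (hg : ContinuousOn g (Icc 0 1)) :
    Integrable (fun x : Icc (0 : ℝ) 1 => g x) ν :=
  (continuousOn_iff_continuous_restrict.1 hg).integrable_of_hasCompactSupport
    (HasCompactSupport.of_compactSpace _)

/-- The values on `[0,1]` determine the integral. [folklore] -/
theorem cfInt_congr {g g' : ℝ → ℝ} (h : ∀ y ∈ Icc (0 : ℝ) 1, g y = g' y) :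
    cfInt ν g = cfInt ν g' := by
  unfold cfInt
  congr 1
  funext x
  exact h x x.2

/-- Monotonicity of the integral. [folklore] -/
theorem cfInt_mono [IsFiniteMeasure ν] {g g' : ℝ → ℝ} (hg : ContinuousOn g (Icc 0 1))
    (hg' : ContinuousOn g' (Icc 0 1)) (h : ∀ y ∈ Icc (0 : ℝ) 1, g y ≤ g' y) :
    cfInt ν g ≤ cfInt ν g' :=
  integral_mono (cfIntegrable ν hg) (cfIntegrable ν hg') fun x => h x x.2

/-- Integral of a constant against a probability measure. [folklore] -/
theorem cfInt_const [IsProbabilityMeasure ν] (c : ℝ) : cfInt ν (fun _ => c) = c := by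
  simp [cfInt]

/-- Additivity of the integral. [folklore] -/
theorem cfInt_add [IsFiniteMeasure ν] {g g' : ℝ → ℝ} (hg : ContinuousOn g (Icc 0 1))
    (hg' : ContinuousOn g' (Icc 0 1)) :
    cfInt ν (fun y => g y + g' y) = cfInt ν g + cfInt ν g' :=
  integral_add (cfIntegrable ν hg) (cfIntegrable ν hg')

/-- The integral of a difference. [folklore] -/
theorem cfInt_sub [IsFiniteMeasure ν] {g g' : ℝ → ℝ} (hg : ContinuousOn g (Icc 0 1))
    (hg' : ContinuousOn g' (Icc 0 1)) :
    cfInt ν (fun y => g y - g' y) = cfInt ν g - cfInt ν g' :=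
  integral_sub (cfIntegrable ν hg) (cfIntegrable ν hg')

/-- Homogeneity of the integral. [folklore] -/
theorem cfInt_const_mul (c : ℝ) (g : ℝ → ℝ) : cfInt ν (fun y => c * g y) = c * cfInt ν g :=
  integral_const_mul c _

/-- **Lower bound from the normalisation:** for `g ∈ C_K` and a probability measure `ν`,
`e^{-K} ∫ g dν ≤ g(y)` on `[0,1]`. [folklore] -/
theorem CfCone.exp_neg_mul_cfInt_le [IsProbabilityMeasure ν] {K : ℝ} {g : ℝ → ℝ} (h : CfCone K g)
    (hK : 0 ≤ K) {y : ℝ} (hy : y ∈ Icc (0 : ℝ) 1) : Real.exp (-K) * cfInt ν g ≤ g y := by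
  have hz : ∀ z ∈ Icc (0 : ℝ) 1, g z ≤ (fun _ => Real.exp K * g y) z :=
    fun z hz => h.le_exp_mul hK hz hy
  have h1 := cfInt_mono ν (h.continuousOn hK) continuousOn_const hz
  rw [cfInt_const] at h1
  have hprod : Real.exp (-K) * Real.exp K = 1 := by
    rw [← Real.exp_add, neg_add_cancel, Real.exp_zero]
  calc Real.exp (-K) * cfInt ν g ≤ Real.exp (-K) * (Real.exp K * g y) :=
        mul_le_mul_of_nonneg_left h1 (Real.exp_pos _).le
    _ = g y := by rw [← mul_assoc, hprod, one_mul]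

/-- **Upper bound from the normalisation:** for `g ∈ C_K` and a probability measure `ν`,
`g(y) ≤ e^{K} ∫ g dν` on `[0,1]`. [folklore] -/
theorem CfCone.le_exp_mul_cfInt [IsProbabilityMeasure ν] {K : ℝ} {g : ℝ → ℝ} (h : CfCone K g)
    (hK : 0 ≤ K) {y : ℝ} (hy : y ∈ Icc (0 : ℝ) 1) : g y ≤ Real.exp K * cfInt ν g := by
  have hz : ∀ z ∈ Icc (0 : ℝ) 1, (fun _ => g y) z ≤ (fun z => Real.exp K * g z) z :=
    fun z hz => h.le_exp_mul hK hy hz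
  have h1 := cfInt_mono ν (g' := fun z => Real.exp K * g z) continuousOn_const
    (continuousOn_const.mul (h.continuousOn hK)) hz
  rwa [cfInt_const, cfInt_const_mul] at h1

/-- **Positivity of the integral** on the cone: `0 < ∫ g dν` for `g ∈ C_K`, `ν` a probability
measure. [folklore] -/
theorem CfCone.cfInt_pos [IsProbabilityMeasure ν] {K : ℝ} {g : ℝ → ℝ} (h : CfCone K g)
    (hK : 0 ≤ K) : 0 < cfInt ν g := by
  have h0 : (0 : ℝ) ∈ Icc (0 : ℝ) 1 := ⟨le_rfl, zero_le_one⟩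
  have h1 := h.le_exp_mul_cfInt ν hK h0
  have h2 := h.pos 0 h0
  exact (mul_pos_iff_of_pos_left (Real.exp_pos K)).1 (h2.trans_le h1)

end Integral

/-! ### Eigenmeasures: `∫ L_sⁿ g dν = λⁿ ∫ g dν` -/

section Eigenmeasure

variable (hA : ∀ a ∈ A, 1 ≤ a)
include hA

/-- The transfer operator preserves continuity on `[0,1]`. [folklore] -/
theorem continuousOn_cfTransfer (s : ℝ) {g : ℝ → ℝ} (hg : ContinuousOn g (Icc 0 1)) :
    ContinuousOn (cfTransfer A s g) (Icc 0 1) := by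
  set F : C(Icc (0 : ℝ) 1, ℝ) := ⟨(Icc (0 : ℝ) 1).restrict g, continuousOn_iff_continuous_restrict.1 hg⟩
  have hFg : ∀ y ∈ Icc (0 : ℝ) 1, cfExtend F y = g y := fun y hy => by
    rw [cfExtend_of_mem _ hy]; rfl
  have heq : (Icc (0 : ℝ) 1).restrict (cfTransfer A s g) = fun x => cfTransferC A hA s F x := by
    funext x
    rw [cfTransferC_apply]
    have := cfTransfer_iterate_congr hA s 1 hFg x.2
    simpa using this.symm
  rw [continuousOn_iff_continuous_restrict, heq]
  exact (cfTransferC A hA s F).continuous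

/-- The iterates of the transfer operator preserve continuity on `[0,1]`. [folklore] -/
theorem continuousOn_cfTransfer_iterate (s : ℝ) {g : ℝ → ℝ} (hg : ContinuousOn g (Icc 0 1)) :
    ∀ n : ℕ, ContinuousOn ((cfTransfer A s)^[n] g) (Icc 0 1)
  | 0 => by simpa using hg
  | n + 1 => by
      rw [Function.iterate_succ_apply']
      exact continuousOn_cfTransfer hA s (continuousOn_cfTransfer_iterate s hg n)

variable (ν : Measure (Icc (0 : ℝ) 1)) {s : ℝ}
  (hν : ∀ f : C(Icc (0 : ℝ) 1, ℝ), ∫ x, cfTransferC A hA s f x ∂ν = cfEig A s * ∫ x, f x ∂ν)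
include hν

/-- **The eigenmeasure relation for functions continuous on `[0,1]`:**
`∫ L_s g dν = e^{P_A(s)} ∫ g dν`. [cite: MageeOhWinter2019, Thm. 10] -/
theorem cfInt_cfTransfer {g : ℝ → ℝ} (hg : ContinuousOn g (Icc 0 1)) :
    cfInt ν (cfTransfer A s g) = cfEig A s * cfInt ν g := by
  set F : C(Icc (0 : ℝ) 1, ℝ) := ⟨(Icc (0 : ℝ) 1).restrict g, continuousOn_iff_continuous_restrict.1 hg⟩
  have hFg : ∀ y ∈ Icc (0 : ℝ) 1, cfExtend F y = g y := fun y hy => by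
    rw [cfExtend_of_mem _ hy]; rfl
  have h1 : cfInt ν (cfTransfer A s g) = ∫ x, cfTransferC A hA s F x ∂ν := by
    unfold cfInt
    congr 1
    funext x
    rw [cfTransferC_apply]
    have := cfTransfer_iterate_congr hA s 1 hFg x.2
    simpa using this.symm
  have h2 : cfInt ν g = ∫ x, F x ∂ν := rfl
  rw [h1, h2, hν F]

/-- **Iterated eigenmeasure relation:** `∫ L_sⁿ g dν = e^{n P_A(s)} ∫ g dν` for `g` continuous on
`[0,1]`. [cite: MageeOhWinter2019, Thm. 10] -/
theorem cfInt_cfTransfer_iterate {g : ℝ → ℝ} (hg : ContinuousOn g (Icc 0 1)) :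
    ∀ n : ℕ, cfInt ν ((cfTransfer A s)^[n] g) = cfEig A s ^ n * cfInt ν g
  | 0 => by simp
  | n + 1 => by
      rw [Function.iterate_succ_apply',
        cfInt_cfTransfer hA ν hν (continuousOn_cfTransfer_iterate hA s hg n),
        cfInt_cfTransfer_iterate hg n, pow_succ]
      ring

end Eigenmeasure

/-! ### Bowen's iteration: constants -/

/-- Bowen's constant `η(s) = e^{-(4s+1)} / (2 e^{2s} (6s+2) e^{4s+2}) ∈ (0, 1/2]` for the cones
`C_{4s+2} ⊋ C_{4s+1}`. [folklore] -/
def cfEta (s : ℝ) : ℝ :=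
  Real.exp (-(4 * s + 1)) / (2 * Real.exp (2 * s) * ((6 * s + 2) * Real.exp (4 * s + 2)))

/-- The contraction rate `θ(s) = (1 - η(s))^{1/2} ∈ (0,1)`. [folklore] -/
def cfTheta (s : ℝ) : ℝ := Real.sqrt (1 - cfEta s)

/-- The constant `C(s) = 5 · 4^s (e^{4s+2} + e^{2s}) / θ(s)` of the decay estimate. [folklore] -/
def cfGapConst (s : ℝ) : ℝ :=
  5 * ((4 : ℝ) ^ s * (Real.exp (4 * s + 2) + Real.exp (2 * s)) / cfTheta s)

/-- `η(s) > 0` for `s ≥ 0`. [folklore] -/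
theorem cfEta_pos {s : ℝ} (hs : 0 ≤ s) : 0 < cfEta s := by
  unfold cfEta; positivity

/-- `η(s) ≤ 1/2` for `s ≥ 0`. [folklore] -/
theorem cfEta_le_half {s : ℝ} (hs : 0 ≤ s) : cfEta s ≤ 1 / 2 := by
  unfold cfEta
  have h1 : Real.exp (-(4 * s + 1)) ≤ 1 := Real.exp_le_one_iff.2 (by linarith)
  have h2 : 1 ≤ Real.exp (2 * s) := Real.one_le_exp (by linarith)
  have h3 : 1 ≤ Real.exp (4 * s + 2) := Real.one_le_exp (by linarith)
  have h4 : (2 : ℝ) * 1 * 2 ≤ 2 * Real.exp (2 * s) * ((6 * s + 2) * Real.exp (4 * s + 2)) := by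
    have : (2 : ℝ) ≤ (6 * s + 2) * Real.exp (4 * s + 2) := by
      have h5 : (2 : ℝ) * 1 ≤ (6 * s + 2) * Real.exp (4 * s + 2) :=
        mul_le_mul (by linarith) h3 zero_le_one (by linarith)
      linarith
    exact mul_le_mul (mul_le_mul_of_nonneg_left h2 (by norm_num)) this (by norm_num) (by positivity)
  rw [div_le_div_iff₀ (by positivity) (by norm_num : (0 : ℝ) < 2)]
  linarith

/-- `0 < θ(s) < 1` and `θ(s)² = 1 - η(s)` for `s ≥ 0`. [folklore] -/
theorem cfTheta_pos {s : ℝ} (hs : 0 ≤ s) : 0 < cfTheta s :=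
  Real.sqrt_pos.2 (by linarith [cfEta_le_half hs])

/-- `θ(s) < 1` for `s ≥ 0`. [folklore] -/
theorem cfTheta_lt_one {s : ℝ} (hs : 0 ≤ s) : cfTheta s < 1 := by
  rw [cfTheta, Real.sqrt_lt' one_pos, one_pow]
  linarith [cfEta_pos hs]

/-- `θ(s)² = 1 - η(s)` for `s ≥ 0`. [folklore] -/
theorem cfTheta_sq {s : ℝ} (hs : 0 ≤ s) : cfTheta s ^ 2 = 1 - cfEta s :=
  Real.sq_sqrt (by linarith [cfEta_le_half hs])

/-- `C(s) > 0`. [folklore] -/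
theorem cfGapConst_pos {s : ℝ} (hs : 0 ≤ s) : 0 < cfGapConst s := by
  unfold cfGapConst
  have := cfTheta_pos hs
  positivity

/-! ### Bowen's iteration on the normalised cone -/

variable (A) in
/-- The normalised two-step operator `T F = e^{-2P_A(s)} L_s² F`. [folklore] -/
def cfT2 (s : ℝ) (F : ℝ → ℝ) : ℝ → ℝ := fun y => (cfEig A s ^ 2)⁻¹ * (cfTransfer A s)^[2] F y

variable (A) in
/-- Bowen's map `B F = (T F - η h)/(1 - η)` on the normalised cone. [folklore] -/
def cfBowen (s : ℝ) (h F : ℝ → ℝ) : ℝ → ℝ :=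
  fun y => (1 - cfEta s)⁻¹ * (cfT2 A s F y - cfEta s * h y)

/-- Pointwise formula for `T`. [folklore] -/
theorem cfT2_apply (s : ℝ) (F : ℝ → ℝ) (y : ℝ) :
    cfT2 A s F y = (cfEig A s ^ 2)⁻¹ * (cfTransfer A s)^[2] F y := rfl

/-- Pointwise formula for Bowen's map. [folklore] -/
theorem cfBowen_apply (s : ℝ) (h F : ℝ → ℝ) (y : ℝ) :
    cfBowen A s h F y = (1 - cfEta s)⁻¹ * (cfT2 A s F y - cfEta s * h y) := rfl

section Bowen

variable (hA : ∀ a ∈ A, 1 ≤ a) {s : ℝ} (hs : 0 ≤ s)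
  (ν : Measure (Icc (0 : ℝ) 1)) [IsProbabilityMeasure ν]
  (hν : ∀ f : C(Icc (0 : ℝ) 1, ℝ), ∫ x, cfTransferC A hA s f x ∂ν = cfEig A s * ∫ x, f x ∂ν)
  {h : ℝ → ℝ} (hh : CfCone (2 * s) h)
  (heig : ∀ x ∈ Icc (0 : ℝ) 1, cfTransfer A s h x = cfEig A s * h x) (hh1 : cfInt ν h = 1)

include hA hs in
/-- **`T` maps `C_{4s+2}` into `C_{4s+1}`** (cone contraction of `L_s²`). [folklore] -/
theorem cfCone_cfT2 (hne : A.Nonempty) {F : ℝ → ℝ} (hF : CfCone (4 * s + 2) F) : CfCone (4 * s + 1) (cfT2 A s F) := by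
  have hc : 0 < (cfEig A s ^ 2)⁻¹ := inv_pos.2 (pow_pos (cfEig_pos s) 2)
  refine CfCone.smul ⟨fun y hy => cfTransfer_iterate_pos_of_pos hA hne s 2 hF.pos hy,
    fun x hx y hy => ?_⟩ hc
  have h := (cfTransfer_iterate_two_logLip hA hs (by linarith : 4 * s ≤ 4 * s + 2) hF.pos hF.le
    hx hy).1
  have e : 2 * s + (4 * s + 2) / 2 = 4 * s + 1 := by ring
  rwa [e] at h

omit [IsProbabilityMeasure ν] in
include hν in
/-- **`T` preserves the normalisation** `∫ F dν = 1`. [folklore] -/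
theorem cfInt_cfT2 {F : ℝ → ℝ} (hF : ContinuousOn F (Icc 0 1)) (hF1 : cfInt ν F = 1) :
    cfInt ν (cfT2 A s F) = 1 := by
  unfold cfT2
  rw [cfInt_const_mul, cfInt_cfTransfer_iterate hA ν hν hF 2, hF1, mul_one,
    inv_mul_cancel₀ (pow_pos (cfEig_pos s) 2).ne']

include hs hh hh1 in
/-- The normalised eigenfunction is bounded by `e^{2s}`. [folklore] -/
theorem cfEigenfun_le_exp {y : ℝ} (hy : y ∈ Icc (0 : ℝ) 1) : h y ≤ Real.exp (2 * s) := by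
  simpa [hh1] using hh.le_exp_mul_cfInt ν (by linarith) hy

include hA hs hν hh hh1 in
/-- **Bowen's map preserves the normalised cone:** `F ∈ C_{4s+2}`, `∫ F dν = 1` imply
`B F ∈ C_{4s+2}`, `∫ B F dν = 1`. [folklore] -/
theorem cfBowen_mem (hne : A.Nonempty) {F : ℝ → ℝ} (hF : CfCone (4 * s + 2) F) (hF1 : cfInt ν F = 1) :
    CfCone (4 * s + 2) (cfBowen A s h F) ∧ cfInt ν (cfBowen A s h F) = 1 := by
  have hK0 : (0 : ℝ) ≤ 4 * s + 2 := by linarith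
  have hK'0 : (0 : ℝ) ≤ 4 * s + 1 := by linarith
  have hT := cfCone_cfT2 hA hs hne hF
  have hT1 := cfInt_cfT2 hA ν hν (hF.continuousOn hK0) hF1
  have hTm : ∀ y ∈ Icc (0 : ℝ) 1, Real.exp (-(4 * s + 1)) ≤ cfT2 A s F y := fun y hy => by
    simpa [hT1] using hT.exp_neg_mul_cfInt_le ν hK'0 hy
  have hhM : ∀ y ∈ Icc (0 : ℝ) 1, h y ≤ Real.exp (2 * s) := fun y hy => cfEigenfun_le_exp hs ν hh hh1 hy
  have hη := (cfEta_pos hs).le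
  have h6 : (0 : ℝ) < 6 * s + 2 := by positivity
  have hηR : cfEta s * Real.exp (2 * s) *
      ((4 * s + 2 + 2 * s) * Real.exp (4 * s + 2) / (4 * s + 2 - (4 * s + 1))) ≤
      Real.exp (-(4 * s + 1)) / 2 := by
    have e0 : (4 * s + 2 - (4 * s + 1) : ℝ) = 1 := by ring
    have e1 : (4 * s + 2 + 2 * s : ℝ) = 6 * s + 2 := by ring
    rw [e0, div_one, e1]
    unfold cfEta
    rw [div_mul_eq_mul_div, div_mul_eq_mul_div, div_le_div_iff₀ (by positivity) two_pos]
    exact le_of_eq (by ring)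
  have hsub := CfCone.sub_smul hK'0 (by linarith) hs hT hh (Real.exp_pos _) hTm hhM hη hηR
  have h1η : 0 < 1 - cfEta s := by linarith [cfEta_le_half hs]
  refine ⟨hsub.smul (inv_pos.2 h1η), ?_⟩
  unfold cfBowen
  rw [cfInt_const_mul, cfInt_sub ν (g' := fun y => cfEta s * h y) (hT.continuousOn hK'0)
      (continuousOn_const.mul (hh.continuousOn (by linarith))), cfInt_const_mul, hT1, hh1, mul_one,
    inv_mul_cancel₀ h1η.ne']

include hA hs hν hh hh1 in
/-- **The Bowen iterates stay in the normalised cone.** [folklore] -/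
theorem cfBowen_iterate_mem (hne : A.Nonempty) {f : ℝ → ℝ} (hf : CfCone (4 * s + 2) f)
    (hf1 : cfInt ν f = 1) :
    ∀ k : ℕ, CfCone (4 * s + 2) ((cfBowen A s h)^[k] f) ∧ cfInt ν ((cfBowen A s h)^[k] f) = 1
  | 0 => ⟨hf, hf1⟩
  | k + 1 => by
      rw [Function.iterate_succ_apply']
      obtain ⟨h1, h2⟩ := cfBowen_iterate_mem hne hf hf1 k
      exact cfBowen_mem hA hs ν hν hh hh1 hne h1 h2

include hA hs heig in
/-- **Unrolling Bowen's iteration:**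
`L_s^{2k} f = e^{2kP} ((1 - (1-η)^k) h + (1-η)^k B^k f)` on `[0,1]`. [folklore] -/
theorem cfBowen_unroll (f : ℝ → ℝ) :
    ∀ (k : ℕ) {x : ℝ}, x ∈ Icc (0 : ℝ) 1 →
      (cfTransfer A s)^[2 * k] f x = cfEig A s ^ (2 * k) *
        ((1 - (1 - cfEta s) ^ k) * h x + (1 - cfEta s) ^ k * (cfBowen A s h)^[k] f x)
  | 0, x, _ => by simp
  | k + 1, x, hx => by
      have e1 : 2 * (k + 1) = 2 + 2 * k := by ring
      rw [e1, Function.iterate_add_apply]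
      have IH : ∀ y ∈ Icc (0 : ℝ) 1, (cfTransfer A s)^[2 * k] f y =
          (fun y => cfEig A s ^ (2 * k) * ((1 - (1 - cfEta s) ^ k) * h y +
            (1 - cfEta s) ^ k * (cfBowen A s h)^[k] f y)) y :=
        fun y hy => cfBowen_unroll f k hy
      rw [cfTransfer_iterate_congr hA s 2 IH hx,
        cfTransfer_iterate_const_mul hA s 2 (cfEig A s ^ (2 * k))
          (fun y => (1 - (1 - cfEta s) ^ k) * h y + (1 - cfEta s) ^ k * (cfBowen A s h)^[k] f y) hx,
        cfTransfer_iterate_add hA s 2 (fun y => (1 - (1 - cfEta s) ^ k) * h y)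
          (fun y => (1 - cfEta s) ^ k * (cfBowen A s h)^[k] f y) hx,
        cfTransfer_iterate_const_mul hA s 2 (1 - (1 - cfEta s) ^ k) h hx,
        cfTransfer_iterate_const_mul hA s 2 ((1 - cfEta s) ^ k) ((cfBowen A s h)^[k] f) hx,
        cfTransfer_iterate_of_eigen hA heig 2 hx]
      have h1η : (1 : ℝ) - cfEta s ≠ 0 := by linarith [cfEta_le_half hs]
      have hlam2 : cfEig A s ^ 2 ≠ 0 := (pow_pos (cfEig_pos s) 2).ne'
      have hT : (cfTransfer A s)^[2] ((cfBowen A s h)^[k] f) x =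
          cfEig A s ^ 2 * (cfEta s * h x + (1 - cfEta s) * (cfBowen A s h)^[k + 1] f x) := by
        rw [Function.iterate_succ_apply' (cfBowen A s h) k f, cfBowen_apply, cfT2_apply,
          mul_inv_cancel_left₀ h1η, add_sub_cancel, mul_inv_cancel_left₀ hlam2]
      rw [hT]
      ring

include hA hs hν hh heig hh1 in
/-- **Exponential convergence along even times on the normalised cone:**
`|e^{-2kP} L_s^{2k} f (x) - h(x)| ≤ (1-η)^k (e^{4s+2} + e^{2s})` for `f ∈ C_{4s+2}`, `∫ f dν = 1`.
[folklore] -/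
theorem cfBowen_even_bound (hne : A.Nonempty) {f : ℝ → ℝ} (hf : CfCone (4 * s + 2) f)
    (hf1 : cfInt ν f = 1) (k : ℕ)
    {x : ℝ} (hx : x ∈ Icc (0 : ℝ) 1) :
    |(cfEig A s ^ (2 * k))⁻¹ * (cfTransfer A s)^[2 * k] f x - h x| ≤
      (1 - cfEta s) ^ k * (Real.exp (4 * s + 2) + Real.exp (2 * s)) := by
  have hK0 : (0 : ℝ) ≤ 4 * s + 2 := by linarith
  obtain ⟨hFk, hFk1⟩ := cfBowen_iterate_mem hA hs ν hν hh hh1 hne hf hf1 k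
  rw [cfBowen_unroll hA hs heig f k hx, inv_mul_cancel_left₀ (pow_pos (cfEig_pos s) _).ne']
  have hF_le : (cfBowen A s h)^[k] f x ≤ Real.exp (4 * s + 2) := by
    simpa [hFk1] using hFk.le_exp_mul_cfInt ν hK0 hx
  have hF_pos := hFk.pos x hx
  have hh_le : h x ≤ Real.exp (2 * s) := cfEigenfun_le_exp hs ν hh hh1 hx
  have hh_pos := hh.pos x hx
  have hq : 0 ≤ (1 - cfEta s) ^ k := pow_nonneg (by linarith [cfEta_le_half hs]) k
  have e : (1 - (1 - cfEta s) ^ k) * h x + (1 - cfEta s) ^ k * (cfBowen A s h)^[k] f x - h x =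
      (1 - cfEta s) ^ k * ((cfBowen A s h)^[k] f x - h x) := by ring
  rw [e, abs_mul, abs_of_nonneg hq]
  refine mul_le_mul_of_nonneg_left ?_ hq
  rw [abs_le]
  constructor <;> linarith

include hA hs hν hh heig hh1 in
/-- **Exponential convergence on the normalised cone** ([MageeOhWinter2019, Thm. 10 (3)] on
`C_{4s+2}`): `|e^{-nP} L_sⁿ f (x) - h(x)| ≤ (4^s (e^{4s+2} + e^{2s}) / θ) θⁿ` for `f ∈ C_{4s+2}`
with `∫ f dν = 1`. [cite: MageeOhWinter2019, Thm. 10] -/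
theorem cfTransfer_decay_cone_normalised (hne : A.Nonempty) {f : ℝ → ℝ} (hf : CfCone (4 * s + 2) f)
    (hf1 : cfInt ν f = 1) (n : ℕ) {x : ℝ} (hx : x ∈ Icc (0 : ℝ) 1) :
    |(cfEig A s ^ n)⁻¹ * (cfTransfer A s)^[n] f x - h x| ≤
      (4 : ℝ) ^ s * (Real.exp (4 * s + 2) + Real.exp (2 * s)) / cfTheta s * cfTheta s ^ n := by
  obtain ⟨k, r, hr, rfl⟩ : ∃ k r : ℕ, r < 2 ∧ n = r + 2 * k :=
    ⟨n / 2, n % 2, Nat.mod_lt _ two_pos, by omega⟩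
  set C₁ : ℝ := Real.exp (4 * s + 2) + Real.exp (2 * s) with hC₁
  set D : ℝ → ℝ := fun y => (cfEig A s ^ (2 * k))⁻¹ * (cfTransfer A s)^[2 * k] f y - h y with hD
  have hDb : ∀ y ∈ Icc (0 : ℝ) 1, |D y| ≤ (1 - cfEta s) ^ k * C₁ := fun y hy =>
    cfBowen_even_bound hA hs ν hν hh heig hh1 hne hf hf1 k hy
  have hlam : ∀ m : ℕ, 0 < cfEig A s ^ m := fun m => pow_pos (cfEig_pos s) m
  -- `L^{r+2k} f = λ^{2k} (λ^r h + L^r D)` on `[0,1]`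
  have hI : ∀ y ∈ Icc (0 : ℝ) 1, (cfTransfer A s)^[2 * k] f y =
      (fun y => cfEig A s ^ (2 * k) * (h y + D y)) y := by
    intro y _
    simp only [hD]
    rw [add_sub_cancel, mul_inv_cancel_left₀ (hlam (2 * k)).ne']
  have hsplit : (cfTransfer A s)^[r + 2 * k] f x =
      cfEig A s ^ (2 * k) * (cfEig A s ^ r * h x + (cfTransfer A s)^[r] D x) := by
    rw [Function.iterate_add_apply, cfTransfer_iterate_congr hA s r hI hx,
      cfTransfer_iterate_const_mul hA s r (cfEig A s ^ (2 * k)) (fun y => h y + D y) hx,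
      cfTransfer_iterate_add hA s r h D hx, cfTransfer_iterate_of_eigen hA heig r hx]
  have hkey : (cfEig A s ^ (r + 2 * k))⁻¹ * (cfTransfer A s)^[r + 2 * k] f x - h x =
      (cfEig A s ^ r)⁻¹ * (cfTransfer A s)^[r] D x := by
    rw [hsplit, pow_add, mul_inv, mul_assoc, inv_mul_cancel_left₀ (hlam (2 * k)).ne', mul_add,
      inv_mul_cancel_left₀ (hlam r).ne']
    ring
  rw [hkey]
  -- `|L^r D x| ≤ sup |D| · L^r 1 x ≤ sup |D| · 4^s λ^r`
  have h1 := abs_cfTransfer_iterate_le hA s r hDb hx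
  have h2 := (cfTransfer_iterate_one_div_mem hA hne hs r hx).2
  rw [div_le_iff₀ (hlam r)] at h2
  have hq0 : 0 ≤ (1 - cfEta s) ^ k := pow_nonneg (by linarith [cfEta_le_half hs]) k
  have hC₁0 : 0 ≤ C₁ := by positivity
  have hbound : |(cfEig A s ^ r)⁻¹ * (cfTransfer A s)^[r] D x| ≤ (1 - cfEta s) ^ k * C₁ * (4 : ℝ) ^ s := by
    rw [abs_mul, abs_of_pos (inv_pos.2 (hlam r)), inv_mul_le_iff₀ (hlam r)]
    calc |(cfTransfer A s)^[r] D x| ≤ (1 - cfEta s) ^ k * C₁ * (cfTransfer A s)^[r] (fun _ => 1) x := h1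
      _ ≤ (1 - cfEta s) ^ k * C₁ * ((4 : ℝ) ^ s * cfEig A s ^ r) :=
          mul_le_mul_of_nonneg_left h2 (mul_nonneg hq0 hC₁0)
      _ = cfEig A s ^ r * ((1 - cfEta s) ^ k * C₁ * (4 : ℝ) ^ s) := by ring
  -- `(1-η)^k = θ^{2k} ≤ θ^{r+2k}/θ`
  have hθ := cfTheta_pos hs
  have hθ1 := cfTheta_lt_one hs
  have hpow : (1 - cfEta s) ^ k ≤ cfTheta s ^ (r + 2 * k) / cfTheta s := by
    rw [← cfTheta_sq hs, ← pow_mul, le_div_iff₀ hθ, pow_add, mul_comm]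
    refine mul_le_mul_of_nonneg_right ?_ (pow_nonneg hθ.le _)
    calc cfTheta s = cfTheta s ^ 1 := (pow_one _).symm
      _ ≤ cfTheta s ^ r := pow_le_pow_of_le_one hθ.le hθ1.le (by omega)
  calc |(cfEig A s ^ r)⁻¹ * (cfTransfer A s)^[r] D x| ≤ (1 - cfEta s) ^ k * C₁ * (4 : ℝ) ^ s := hbound
    _ ≤ cfTheta s ^ (r + 2 * k) / cfTheta s * C₁ * (4 : ℝ) ^ s := by gcongr
    _ = (4 : ℝ) ^ s * C₁ / cfTheta s * cfTheta s ^ (r + 2 * k) := by ring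

include hA hs hν hh heig hh1 in
/-- **Exponential convergence on the cone:** for `f ∈ C_{4s+2}`,
`|e^{-nP} L_sⁿ f (x) - (∫ f dν) h(x)| ≤ (∫ f dν) (4^s (e^{4s+2} + e^{2s})/θ) θⁿ` on `[0,1]`.
[cite: MageeOhWinter2019, Thm. 10] -/
theorem cfTransfer_decay_cone (hne : A.Nonempty) {f : ℝ → ℝ} (hf : CfCone (4 * s + 2) f) (n : ℕ)
    {x : ℝ} (hx : x ∈ Icc (0 : ℝ) 1) :
    |(cfEig A s ^ n)⁻¹ * (cfTransfer A s)^[n] f x - cfInt ν f * h x| ≤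
      cfInt ν f * ((4 : ℝ) ^ s * (Real.exp (4 * s + 2) + Real.exp (2 * s)) / cfTheta s *
        cfTheta s ^ n) := by
  have hK0 : (0 : ℝ) ≤ 4 * s + 2 := by linarith
  have hI : 0 < cfInt ν f := hf.cfInt_pos ν hK0
  set g : ℝ → ℝ := fun y => (cfInt ν f)⁻¹ * f y with hg
  have hgc : CfCone (4 * s + 2) g := hf.smul (inv_pos.2 hI)
  have hg1 : cfInt ν g = 1 := by
    simp only [hg]
    rw [cfInt_const_mul, inv_mul_cancel₀ hI.ne']
  have hdec := cfTransfer_decay_cone_normalised hA hs ν hν hh heig hh1 hne hgc hg1 n hx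
  have hfg : ∀ y ∈ Icc (0 : ℝ) 1, f y = (fun y => cfInt ν f * g y) y := by
    intro y _
    simp only [hg]
    rw [mul_inv_cancel_left₀ hI.ne']
  rw [cfTransfer_iterate_congr hA s n hfg hx, cfTransfer_iterate_const_mul hA s n _ g hx]
  have e : (cfEig A s ^ n)⁻¹ * (cfInt ν f * (cfTransfer A s)^[n] g x) - cfInt ν f * h x =
      cfInt ν f * ((cfEig A s ^ n)⁻¹ * (cfTransfer A s)^[n] g x - h x) := by ring
  rw [e, abs_mul, abs_of_pos hI]
  exact mul_le_mul_of_nonneg_left hdec hI.le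

include hA hs hν hh heig hh1 in
/-- **Exponential convergence for Lipschitz functions** ([MageeOhWinter2019, Thm. 10 (3)] for
`Γ_A`, concrete form): if `|f| ≤ M` and `Lip(f) ≤ L` on `[0,1]` (`M, L ≥ 0`), then for all `n`
and `x ∈ [0,1]`, `|e^{-nP_A(s)} (L_sⁿ f)(x) - (∫ f dν) h(x)| ≤ C(s) θ(s)ⁿ (M + L)`.
[cite: MageeOhWinter2019, Thm. 10] -/
theorem cfTransfer_decay_lipschitz (hne : A.Nonempty) {f : ℝ → ℝ} {M L : ℝ} (hM0 : 0 ≤ M) (hL0 : 0 ≤ L)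
    (hM : ∀ y ∈ Icc (0 : ℝ) 1, |f y| ≤ M)
    (hL : ∀ x ∈ Icc (0 : ℝ) 1, ∀ y ∈ Icc (0 : ℝ) 1, |f x - f y| ≤ L * |x - y|) (n : ℕ) {x : ℝ}
    (hx : x ∈ Icc (0 : ℝ) 1) :
    |(cfEig A s ^ n)⁻¹ * (cfTransfer A s)^[n] f x - cfInt ν f * h x| ≤
      cfGapConst s * cfTheta s ^ n * (M + L) := by
  set C₀ : ℝ := (4 : ℝ) ^ s * (Real.exp (4 * s + 2) + Real.exp (2 * s)) / cfTheta s with hC₀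
  have hθ := cfTheta_pos hs
  have hC₀0 : 0 ≤ C₀ := by rw [hC₀]; positivity
  have hGap : cfGapConst s = 5 * C₀ := rfl
  rcases (add_nonneg hM0 hL0).eq_or_lt with hML | hML
  · -- degenerate case: `f = 0` on `[0,1]`
    have hM' : M = 0 := by linarith [hML.symm.le]
    have hf0 : ∀ y ∈ Icc (0 : ℝ) 1, f y = (fun y => 0 * f y) y := by
      intro y hy
      have := hM y hy
      rw [hM'] at this
      have := abs_nonpos_iff.1 this
      simp [this]
    have hI0 : cfInt ν f = 0 := by
      rw [cfInt_congr ν hf0, cfInt_const_mul, zero_mul]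
    rw [cfTransfer_iterate_congr hA s n hf0 hx, cfTransfer_iterate_const_mul hA s n 0 f hx, hI0,
      ← hML]
    simp
  -- main case: shift into the cone
  set K : ℝ := 4 * s + 2 with hK
  have hKpos : 0 < K := by rw [hK]; linarith
  set c : ℝ := M + L / K + (M + L) with hc
  have hcpos : 0 < c := by rw [hc]; linarith [div_nonneg hL0 hKpos.le]
  have hMc : M + L / K < c := by rw [hc]; linarith
  have hg : CfCone K (fun y => f y + c) := CfCone.of_lipschitz hKpos hL0 hMc hM hL
  have hcc : CfCone K (fun _ => c) := CfCone.const hcpos hKpos.le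
  -- decay for `f + c` and for the constant `c`
  have h1 := cfTransfer_decay_cone hA hs ν hν hh heig hh1 hne hg n hx
  have h2 := cfTransfer_decay_cone hA hs ν hν hh heig hh1 hne hcc n hx
  -- linearity: `f = (f + c) - c` on `[0,1]`
  have hfcont : ContinuousOn f (Icc 0 1) := by
    have hLip : LipschitzOnWith L.toNNReal f (Icc 0 1) := by
      refine LipschitzOnWith.of_dist_le_mul fun x hx y hy => ?_
      rw [Real.dist_eq, Real.dist_eq]
      exact (hL x hx y hy).trans (mul_le_mul_of_nonneg_right (Real.le_coe_toNNReal L) (abs_nonneg _))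
    exact hLip.continuousOn
  have hsplitf : ∀ y ∈ Icc (0 : ℝ) 1, f y = (fun y => (f y + c) + (-1) * c) y := by
    intro y _; ring
  have hLf : (cfTransfer A s)^[n] f x =
      (cfTransfer A s)^[n] (fun y => f y + c) x - (cfTransfer A s)^[n] (fun _ => c) x := by
    rw [cfTransfer_iterate_congr hA s n hsplitf hx,
      cfTransfer_iterate_add hA s n (fun y => f y + c) (fun _ => (-1) * c) hx,
      cfTransfer_iterate_const_mul hA s n (-1) (fun _ => c) hx]
    ring
  have hIf : cfInt ν f = cfInt ν (fun y => f y + c) - cfInt ν (fun _ => c) := by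
    rw [cfInt_add ν hfcont continuousOn_const, cfInt_const]
    ring
  have hIg : cfInt ν (fun y => f y + c) ≤ M + c := by
    rw [cfInt_add ν hfcont continuousOn_const, cfInt_const]
    have : cfInt ν f ≤ cfInt ν (fun _ => M) :=
      cfInt_mono ν hfcont continuousOn_const fun y hy => (abs_le.1 (hM y hy)).2
    rw [cfInt_const] at this
    linarith
  have hIc : cfInt ν (fun _ => c) = c := cfInt_const ν c
  have hIg0 : 0 ≤ cfInt ν (fun y => f y + c) := (hg.cfInt_pos ν hKpos.le).le
  -- combine
  have e : (cfEig A s ^ n)⁻¹ * (cfTransfer A s)^[n] f x - cfInt ν f * h x =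
      ((cfEig A s ^ n)⁻¹ * (cfTransfer A s)^[n] (fun y => f y + c) x - cfInt ν (fun y => f y + c) * h x) -
      ((cfEig A s ^ n)⁻¹ * (cfTransfer A s)^[n] (fun _ => c) x - cfInt ν (fun _ => c) * h x) := by
    rw [hLf, hIf]; ring
  rw [e]
  refine (abs_sub _ _).trans ?_
  have hθn : 0 ≤ C₀ * cfTheta s ^ n := mul_nonneg hC₀0 (pow_nonneg hθ.le n)
  have hK2 : L / K ≤ L := by
    rw [div_le_iff₀ hKpos, hK]
    nlinarith
  calc |(cfEig A s ^ n)⁻¹ * (cfTransfer A s)^[n] (fun y => f y + c) x - cfInt ν (fun y => f y + c) * h x| +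
        |(cfEig A s ^ n)⁻¹ * (cfTransfer A s)^[n] (fun _ => c) x - cfInt ν (fun _ => c) * h x|
      ≤ cfInt ν (fun y => f y + c) * (C₀ * cfTheta s ^ n) + cfInt ν (fun _ => c) * (C₀ * cfTheta s ^ n) :=
        add_le_add h1 h2
    _ ≤ (M + c) * (C₀ * cfTheta s ^ n) + c * (C₀ * cfTheta s ^ n) := by
        rw [hIc]; gcongr
    _ = (M + 2 * c) * (C₀ * cfTheta s ^ n) := by ring
    _ ≤ (5 * (M + L)) * (C₀ * cfTheta s ^ n) := by
        refine mul_le_mul_of_nonneg_right ?_ hθn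
        rw [hc]; linarith
    _ = cfGapConst s * cfTheta s ^ n * (M + L) := by rw [hGap]; ring

end Bowen

/-! ### The spectral gap (Ruelle–Perron–Frobenius (3)) -/

section Main

variable (hA : ∀ a ∈ A, 1 ≤ a)
include hA

/-- **Ruelle–Perron–Frobenius theorem for `Γ_A`, spectral gap** ([MageeOhWinter2019, Thm. 10
(1)–(3)] for the continued fractions semigroup on the unit interval, in concrete form): for
`s ≥ 0` there are a probability measure `ν` on `[0,1]` with `L_s^* ν = e^{P_A(s)} ν` and a positive
function `h ∈ C_{2s}` with `L_s h = e^{P_A(s)} h`, `∫ h dν = 1`, such that for every `f` with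
`|f| ≤ M`, `Lip(f) ≤ L` on `[0,1]`,
`|e^{-nP_A(s)} (L_sⁿ f)(x) - (∫ f dν) h(x)| ≤ C(s) θ(s)ⁿ (M + L)` for all `n` and `x ∈ [0,1]`,
where `0 < θ(s) = cfTheta s < 1` and `C(s) = cfGapConst s`. [cite: MageeOhWinter2019, Thm. 10] -/
theorem cfTransfer_spectralGap (hne : A.Nonempty) {s : ℝ} (hs : 0 ≤ s) :
    ∃ (h : ℝ → ℝ) (ν : Measure (Icc (0 : ℝ) 1)), IsProbabilityMeasure ν ∧
      (∀ f : C(Icc (0 : ℝ) 1, ℝ), ∫ x, cfTransferC A hA s f x ∂ν = cfEig A s * ∫ x, f x ∂ν) ∧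
      CfCone (2 * s) h ∧ (∀ x ∈ Icc (0 : ℝ) 1, cfTransfer A s h x = cfEig A s * h x) ∧
      cfInt ν h = 1 ∧
      ∀ (f : ℝ → ℝ) (M L : ℝ), 0 ≤ M → 0 ≤ L → (∀ y ∈ Icc (0 : ℝ) 1, |f y| ≤ M) →
        (∀ x ∈ Icc (0 : ℝ) 1, ∀ y ∈ Icc (0 : ℝ) 1, |f x - f y| ≤ L * |x - y|) →
        ∀ n : ℕ, ∀ x ∈ Icc (0 : ℝ) 1,
          |(cfEig A s ^ n)⁻¹ * (cfTransfer A s)^[n] f x - cfInt ν f * h x| ≤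
            cfGapConst s * cfTheta s ^ n * (M + L) := by
  -- the eigenmeasure, normalised to a probability measure
  obtain ⟨ν₀, hfin, hν0, hν₀⟩ := exists_cfTransfer_eigenmeasure hA hne hs
  haveI := hfin
  haveI : NeZero ν₀ := ⟨MeasureTheory.Measure.measure_univ_ne_zero.1 hν0⟩
  set ν : Measure (Icc (0 : ℝ) 1) := (ν₀ univ)⁻¹ • ν₀ with hνdef
  haveI hprob : IsProbabilityMeasure ν := isProbabilityMeasureSMul
  have hν : ∀ f : C(Icc (0 : ℝ) 1, ℝ), ∫ x, cfTransferC A hA s f x ∂ν = cfEig A s * ∫ x, f x ∂ν := by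
    intro f
    rw [hνdef, integral_smul_measure, integral_smul_measure, hν₀ f, smul_eq_mul, smul_eq_mul]
    ring
  -- the eigenfunction, normalised by `∫ h dν = 1`
  obtain ⟨h₀, hbd, hlip, heig₀⟩ := exists_cfTransfer_eigenfunction hA hne hs
  have h4 : (0 : ℝ) < (4 : ℝ) ^ (-s) := Real.rpow_pos_of_pos (by norm_num) _
  have hL0 : (0 : ℝ) ≤ (4 : ℝ) ^ s * (2 * s * Real.exp (2 * s)) := by positivity
  have hcone₀ : CfCone ((4 : ℝ) ^ s * (2 * s * Real.exp (2 * s)) / (4 : ℝ) ^ (-s)) h₀ :=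
    CfCone.of_lipschitz_of_pos hL0 h4 (fun y hy => (hbd y hy).1) hlip
  have hcone₀' : CfCone (2 * s) h₀ :=
    cfCone_eigen_two_mul hA hs (div_nonneg hL0 h4.le) hcone₀ heig₀
  have hs2 : 0 ≤ 2 * s := by linarith
  have hI₀ : 0 < cfInt ν h₀ := hcone₀'.cfInt_pos ν hs2
  set h : ℝ → ℝ := fun y => (cfInt ν h₀)⁻¹ * h₀ y with hhdef
  have hh : CfCone (2 * s) h := hcone₀'.smul (inv_pos.2 hI₀)
  have heig : ∀ x ∈ Icc (0 : ℝ) 1, cfTransfer A s h x = cfEig A s * h x := by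
    intro x hx
    have := cfTransfer_iterate_const_mul hA s 1 (cfInt ν h₀)⁻¹ h₀ hx
    simp only [Function.iterate_one] at this
    simp only [hhdef]
    rw [this, heig₀ x hx]
    ring
  have hh1 : cfInt ν h = 1 := by
    rw [hhdef, cfInt_const_mul, inv_mul_cancel₀ hI₀.ne']
  exact ⟨h, ν, hprob, hν, hh, heig, hh1, fun f M L hM0 hL0' hM hL n x hx =>
    cfTransfer_decay_lipschitz hA hs ν hν hh heig hh1 hne hM0 hL0' hM hL n hx⟩

end Main

end Literature.NumberTheory.Sieve
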